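import Summits.CriticalPhenomena.PercolationContinuityZ3.Theses.PercNonProliferation
import Literature.Probability.Percolation.SlabCriticality
import Literature.Probability.Percolation.HalfSpacePinnedPairs
import Literature.Probability.Percolation.SubgraphMonotonicity
import HarnessLib

/-!
# Crux `PercNonProliferation.SubpolynomialBlocking` (stmt-CriticalPhenomena-4446), line `slab-ladder-two-curtains` — stub `stub_slabTransfer`

Helper file for the crux skeleton `Cruxes/SubpolynomialBlocking/Lines/slab_ladder_two_curtains.lean`
(lead prover-line-stmt-CriticalPhenomena-4446-c2). Proves exactly the registered stub signature
`stub_slabTransfer`; lands with `--supports stmt-CriticalPhenomena-4446`.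

## The statement (the centred curtain of `ℤ³` IS Newman–Tassion–Wu's slab event)

For every `p ∈ [0,1]` and `n`:

  `P_p^{ℤ³}(curtain0 n) = P_p^{S_{4n}}((slabConn (4n) (sqBox 0 (2n)) (sqBox 0 n) (sqSphere 0 (2n)))ᶜ)`,

where `curtain0 n = {ω | no open path inside B(2n) from the column {v ∈ B(2n) : |v₁|,|v₂| ≤ n}
to the lateral faces {v ∈ B(2n) : |v₁| = 2n ∨ |v₂| = 2n}}` (written out in the signature), the
slab is `S_{4n} = slab 3 (4n) = {x : ℤ³ // 0 ≤ x₀ ≤ 4n}` with its induced graph `slabGraph 3 (4n)`,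
and `slabConn k B X Y = openCrossing (slabLift k B) (slabLift k X) (slabLift k Y)` is the
annulus-crossing event `X̄ ⟷^{B̄} Ȳ` of Duminil-Copin–Sidoravicius–Tassion 2016 / Newman–Tassion–Wu
2017, Cor. 3.2 (4) (`SlabCriticality.lean`).

## The argument (Grimmett 1999, §1.4 p. 13 and §1.6 p. 16)

* RESTRICTION COUPLING. `P_p^{S_k}` is the push-forward of `P_p^{ℤ³}` under
  `restrictConfig Subtype.val` (`bondPercolation_map_comap`), and for ALL `ω` an open path of
  `restrictConfig val ω` inside `S ⊆ S_k` is an open path of `ω` inside `val '' S` and conversely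
  (the two induced open graphs are isomorphic along `Equiv.Set.image val S`):
  `restrictConfig val ⁻¹' openCrossing S A B = openCrossing (val '' S) (val '' A) (val '' B)`
  (`StubSlabTransfer.preimage_restrictConfig_openCrossing`). Hence the slab probability is the
  `ℤ³`-probability of the complement of the OFFSET curtain, living in
  `{0 ≤ x₀ ≤ 4n} × [-2n, 2n]²`.
* SHIFT. The translation `x ↦ x + 2n·e₀` (`Site.shift (Pi.single 0 (2n))`) maps `B(2n)`, the
  column and the lateral faces onto the images under `val` of the lifts of `sqBox 0 (2n)`,
  `sqBox 0 n`, `sqSphere 0 (2n)` (three set identities, linear integer arithmetic), and `P_p` is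
  translation invariant (`bondPercolation_real_preimage_shift`, `preimage_relabel_openCrossing`).

No definitions; all sets are written literally.
-/

noncomputable section

namespace Summit.CriticalPhenomena.PercolationContinuityZ3.Theorems.SubpolynomialBlocking

open MeasureTheory Filter Topology
open Literature.Probability.Percolation Literature.Probability.LatticeModels

namespace StubSlabTransfer

-- adapted from Cruxes/SubpolynomialBlocking/Lines/slab-ladder-two-curtains-SlabTransferProof.lean (planner)

/-! ### (1) Restricted open connections under the restriction coupling -/

section Restrict

variable {V : Type*}

/-- **Restriction correspondence**: `restrictConfig val ω ∈ {x ↔ y in S}` iff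
`ω ∈ {↑x ↔ ↑y in val '' S}` — an open path of the restricted configuration inside `S ⊆ T` is an
open path of `ω` inside the image region and conversely: both are walks in induced open graphs
which are isomorphic along `Equiv.Set.image val S` (Grimmett 1999, §1.4 p. 13, the sublattice
coupling). -/
theorem restrictConfig_mem_openConnIn_iff (T : Set V) (ω : BondConfig V) (S : Set T) (x y : T) :
    restrictConfig (Subtype.val : T → V) ω ∈ openConnIn S x y ↔
      ω ∈ openConnIn (Subtype.val '' S) x.1 y.1 := by
  let φ : ((openGraph (restrictConfig (Subtype.val : T → V) ω)).induce S) ≃g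
      ((openGraph ω).induce (Subtype.val '' S)) :=
    { toEquiv := Equiv.Set.image (Subtype.val : T → V) S Subtype.val_injective
      map_rel_iff' := by
        intro a b
        simp only [SimpleGraph.comap_adj, Function.Embedding.coe_subtype, openGraph_adj,
          Equiv.Set.image_apply, mem_restrictConfig, Sym2.map_mk, ne_eq]
        rw [Subtype.val_injective.eq_iff] }
  constructor
  · rintro ⟨hx, hy, h⟩
    exact ⟨⟨x, hx, rfl⟩, ⟨y, hy, rfl⟩,
      (SimpleGraph.Iso.reachable_iff (φ := φ) (u := ⟨x, hx⟩) (v := ⟨y, hy⟩)).2 h⟩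
  · rintro ⟨⟨a, ha, hav⟩, ⟨b, hb, hbv⟩, h⟩
    have hx : x ∈ S := by rwa [← Subtype.val_injective hav]
    have hy : y ∈ S := by rwa [← Subtype.val_injective hbv]
    exact ⟨hx, hy,
      (SimpleGraph.Iso.reachable_iff (φ := φ) (u := ⟨x, hx⟩) (v := ⟨y, hy⟩)).1 h⟩

/-- **The restriction pulls open crossings back to open crossings of the image sets**:
`restrictConfig val ⁻¹' {A ↔ B in S} = {val '' A ↔ val '' B in val '' S}` (for subsets
`S, A, B` of the vertex subset `T`). -/
theorem preimage_restrictConfig_openCrossing (T : Set V) (S A B : Set T) :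
    restrictConfig (Subtype.val : T → V) ⁻¹' openCrossing S A B =
      openCrossing (Subtype.val '' S) (Subtype.val '' A) (Subtype.val '' B) := by
  ext ω
  simp only [Set.mem_preimage, mem_openCrossing_iff]
  constructor
  · rintro ⟨a, ha, b, hb, h⟩
    exact ⟨a.1, ⟨a, ha, rfl⟩, b.1, ⟨b, hb, rfl⟩,
      (restrictConfig_mem_openConnIn_iff T ω S a b).1 h⟩
  · rintro ⟨x, ⟨a, ha, rfl⟩, y, ⟨b, hb, rfl⟩, h⟩
    exact ⟨a, ha, b, hb, (restrictConfig_mem_openConnIn_iff T ω S a b).2 h⟩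

end Restrict

/-- **The slab measure is the push-forward of the `ℤ³` measure under restriction**
(`bondPercolation_map_comap`; `slabGraph 3 k = (zdGraph 3).induce (slab 3 k)` is the comap
along `Subtype.val`). (Grimmett 1999, §1.4 p. 13.) -/
theorem bondPercolation_slabGraph_eq_map (k : ℕ) (p : unitInterval) :
    bondPercolation (slabGraph 3 k) p =
      (bondPercolation (zdGraph 3) p).map (restrictConfig (Subtype.val : slab 3 k → Site 3)) :=
  (bondPercolation_map_comap (zdGraph 3) (f := (Subtype.val : slab 3 k → Site 3))
    Subtype.val_injective p).symm

/-! ### (2) The shift by `2n·e₀`: three set identities -/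

/-- Membership in the image under `val` of a lift: `z ∈ val '' Ē ↔ 0 ≤ z₀ ≤ k ∧ (z₁, z₂) ∈ E`. -/
theorem mem_image_val_slabLift_iff (k : ℕ) (E : Set (ℤ × ℤ)) (z : Site 3) :
    z ∈ Subtype.val '' slabLift k E ↔ (0 ≤ z 0 ∧ z 0 ≤ (k : ℤ)) ∧ (z 1, z 2) ∈ E := by
  constructor
  · rintro ⟨a, ha, rfl⟩
    exact ⟨a.2, ha⟩
  · rintro ⟨hz, hE⟩
    exact ⟨⟨z, hz⟩, hE, rfl⟩

/-- The coordinates of the shifted point `x + 2n·e₀`. -/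
theorem shift_apply_coords (n : ℕ) (x : Site 3) :
    Site.shift (Pi.single 0 (2 * (n : ℤ))) x 0 = x 0 + 2 * (n : ℤ) ∧
      Site.shift (Pi.single 0 (2 * (n : ℤ))) x 1 = x 1 ∧
        Site.shift (Pi.single 0 (2 * (n : ℤ))) x 2 = x 2 := by
  simp [Site.shift_apply]

/-- `x + 2n·e₀ ∈ val '' (lift of B_{2n}) ↔ x ∈ B(2n)`. -/
theorem shift_mem_image_sqBox_two_iff (n : ℕ) (x : Site 3) :
    Site.shift (Pi.single 0 (2 * (n : ℤ))) x ∈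
        Subtype.val '' slabLift (4 * n) (sqBox (0 : ℤ × ℤ) (2 * n)) ↔ x ∈ box 3 (2 * n) := by
  obtain ⟨h0, h1, h2⟩ := shift_apply_coords n x
  rw [mem_image_val_slabLift_iff, mem_box, Fin.forall_fin_succ, Fin.forall_fin_two, Fin.succ_zero_eq_one,
    Fin.succ_one_eq_two, h0, h1, h2]
  simp only [sqBox, Set.mem_setOf_eq, Prod.fst_zero, Prod.snd_zero, sub_zero, abs_le]
  push_cast
  omega

/-- `x + 2n·e₀ ∈ val '' (lift of B_n) ↔ x ∈ column0 n = {v ∈ B(2n) : |v₁| ≤ n ∧ |v₂| ≤ n}`. -/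
theorem shift_mem_image_sqBox_iff (n : ℕ) (x : Site 3) :
    Site.shift (Pi.single 0 (2 * (n : ℤ))) x ∈
        Subtype.val '' slabLift (4 * n) (sqBox (0 : ℤ × ℤ) n) ↔
      x ∈ {v : Site 3 | v ∈ box 3 (2 * n) ∧ |v 1| ≤ (n : ℤ) ∧ |v 2| ≤ (n : ℤ)} := by
  obtain ⟨h0, h1, h2⟩ := shift_apply_coords n x
  rw [mem_image_val_slabLift_iff, Set.mem_setOf_eq, mem_box, Fin.forall_fin_succ, Fin.forall_fin_two,
    Fin.succ_zero_eq_one, Fin.succ_one_eq_two, h0, h1, h2]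
  simp only [sqBox, Set.mem_setOf_eq, Prod.fst_zero, Prod.snd_zero, sub_zero, abs_le]
  push_cast
  omega

/-- `max a b = c` in linear form. -/
theorem max_eq_iff_linear {a b c : ℤ} : max a b = c ↔ (a ≤ c ∧ b ≤ c) ∧ (c ≤ a ∨ c ≤ b) := by
  rw [le_antisymm_iff, max_le_iff, le_max_iff]

/-- `y + 2n·e₀ ∈ val '' (lift of ∂B_{2n}) ↔ y ∈ lateral0 n = {v ∈ B(2n) : |v₁| = 2n ∨ |v₂| = 2n}`. -/
theorem shift_mem_image_sqSphere_iff (n : ℕ) (y : Site 3) :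
    Site.shift (Pi.single 0 (2 * (n : ℤ))) y ∈
        Subtype.val '' slabLift (4 * n) (sqSphere (0 : ℤ × ℤ) (2 * n)) ↔
      y ∈ {v : Site 3 | v ∈ box 3 (2 * n) ∧ (|v 1| = 2 * (n : ℤ) ∨ |v 2| = 2 * (n : ℤ))} := by
  have h2n : (0 : ℤ) ≤ 2 * (n : ℤ) := by positivity
  obtain ⟨h0, h1, h2⟩ := shift_apply_coords n y
  rw [mem_image_val_slabLift_iff, Set.mem_setOf_eq, mem_box, Fin.forall_fin_succ, Fin.forall_fin_two,
    Fin.succ_zero_eq_one, Fin.succ_one_eq_two, h0, h1, h2]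
  simp only [sqSphere, Set.mem_setOf_eq, Prod.fst_zero, Prod.snd_zero, sub_zero]
  push_cast
  simp only [max_eq_iff_linear, abs_eq h2n, abs_le, le_abs]
  omega

/-- The image of a set under the shift is described by the shifted membership predicate. -/
theorem image_shift_eq_of_iff (n : ℕ) {A B : Set (Site 3)}
    (h : ∀ x, Site.shift (Pi.single 0 (2 * (n : ℤ))) x ∈ B ↔ x ∈ A) :
    B = Site.shift (Pi.single 0 (2 * (n : ℤ))) '' A := by
  ext z
  rw [Equiv.image_eq_preimage_symm, Set.mem_preimage, ← h, Equiv.apply_symm_apply]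

/-- **Translation invariance of the blocking probability**: for the shift `τ = (· + v)` of `ℤ³`,
`P_p((openCrossing (τ '' S) (τ '' A) (τ '' B))ᶜ) = P_p((openCrossing S A B)ᶜ)`
(`preimage_relabel_openCrossing` and `bondPercolation_real_preimage_shift`; Grimmett 1999, §1.6). -/
theorem real_compl_openCrossing_shift (v : Site 3) (p : unitInterval) (S A B : Set (Site 3)) :
    (bondPercolation (zdGraph 3) p).real
        (openCrossing (Site.shift v '' S) (Site.shift v '' A) (Site.shift v '' B))ᶜ =
      (bondPercolation (zdGraph 3) p).real (openCrossing S A B)ᶜ := by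
  rw [← preimage_relabel_openCrossing (Site.shift v) S A B, ← Set.preimage_compl,
    bondPercolation_real_preimage_shift]

end StubSlabTransfer

/-- **Registered stub `stub_slabTransfer`** (line `slab-ladder-two-curtains`, crux
`SubpolynomialBlocking`): THE CURTAIN IS NTW's SLAB EVENT. For every `p` and `n`, the
`ℤ³`-probability of the centred curtain
`{ω | no open path inside B(2n) from {v ∈ B(2n) : |v₁|,|v₂| ≤ n} to {v ∈ B(2n) : |v₁| = 2n ∨ |v₂| = 2n}}`
equals the probability, for bond percolation on the slab graph `slabGraph 3 (4n)`, of the complement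
of the annulus-crossing event `slabConn (4n) (sqBox 0 (2n)) (sqBox 0 n) (sqSphere 0 (2n))`
(Newman–Tassion–Wu 2017, Cor. 3.2 (4); DST 2016 notation `X̄ ⟷^{B̄} Ȳ`). Proof: the restriction
coupling `P_p^{S_{4n}} = P_p^{ℤ³} ∘ (restrictConfig val)⁻¹` with the exact correspondence of
restricted open crossings (`StubSlabTransfer.preimage_restrictConfig_openCrossing`), the three set
identities carrying `B(2n)`, the column and the lateral faces by `x ↦ x + 2n·e₀` onto the images of
the lifts of `B_{2n}`, `B_n`, `∂B_{2n}`, and translation invariance of `P_p`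
(`bondPercolation_real_preimage_shift`). (Grimmett 1999, §1.4 p. 13 and §1.6 p. 16.) -/
theorem stub_slabTransfer :
    ∀ (p : unitInterval) (n : ℕ),
      (bondPercolation (zdGraph 3) p).real
          {ω | ¬ ∃ x ∈ {v : Site 3 | v ∈ box 3 (2 * n) ∧ |v 1| ≤ (n : ℤ) ∧ |v 2| ≤ (n : ℤ)},
            ∃ y ∈ {v : Site 3 | v ∈ box 3 (2 * n) ∧ (|v 1| = 2 * (n : ℤ) ∨ |v 2| = 2 * (n : ℤ))},
              ω ∈ openConnIn (↑(box 3 (2 * n)) : Set (Site 3)) x y} =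
        (bondPercolation (slabGraph 3 (4 * n)) p).real
          (slabConn (4 * n) (sqBox (0 : ℤ × ℤ) (2 * n)) (sqBox (0 : ℤ × ℤ) n)
            (sqSphere (0 : ℤ × ℤ) (2 * n)))ᶜ := by
  intro p n
  have hB := StubSlabTransfer.image_shift_eq_of_iff n
    (fun x => (StubSlabTransfer.shift_mem_image_sqBox_two_iff n x).trans Finset.mem_coe.symm)
  have hX := StubSlabTransfer.image_shift_eq_of_iff n (StubSlabTransfer.shift_mem_image_sqBox_iff n)
  have hY := StubSlabTransfer.image_shift_eq_of_iff n (StubSlabTransfer.shift_mem_image_sqSphere_iff n)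
  rw [StubSlabTransfer.bondPercolation_slabGraph_eq_map,
    map_measureReal_apply (measurable_restrictConfig _) (measurableSet_slabConn _ _ _ _ _).compl,
    Set.preimage_compl, slabConn, StubSlabTransfer.preimage_restrictConfig_openCrossing, hB, hX, hY,
    StubSlabTransfer.real_compl_openCrossing_shift]
  rfl

end Summit.CriticalPhenomena.PercolationContinuityZ3.Theorems.SubpolynomialBlocking

end
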